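import Summits.Parity.GeneralizedHardyLittlewood.Theorems.LiouvilleMADTypeIIToLevelEngine2
import HarnessLib

/-!
# Crux `LiouvilleMAD.LambdaLiouvilleLevel` (stmt-Parity-13325), line `log-power-dispersion`:
stub `stub_typeIIPieceDecomp`

The exact, purely combinatorial reduction of the type-II piece `F_U * G_U` of Vaughan's identity
against the class weight `lam(n) = 1[n ≡ w (q)] λ(n + h)` for ONE modulus `q` — the skeleton's
`TypeIIPieceDecomp`, proved here unfolded as `typeIIPieceDecomp`.  Proof summary:
open the convolution (`Sieve.sum_Ioc_mul_apply_mul_eq_sum_sum`), extend `d` to `(0, U2^J]`, drop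
`d ≤ U` (`F_U = 0`), dyadic blocks `(U2^i, 2U2^i]` each cut into `Ks` pieces at
`E_{i,a} = U2^i + ⌊a U2^i / Ks⌋` (`sum_Ioc_eq_sum_blocks_pieces`); on the piece `a` split
`m ≤ x/d` at `X = ⌊x / E_{i,a+1}⌋ ≤ x/d` (`sum_piece_split`).  MAIN part `m ≤ X`: extend `m` to
`(0, U2^J]` with the indicator `m ≤ X`, drop `m ≤ U` (`G_U = 0`), dyadic boxes in `m`, the boxes
with `U2^i · U2^j > N` vanish — an exact identity with the `ClassTypeIILog`-shaped box sums
(`main_piece_eq`).  BOUNDARY part `X < m ≤ x/d`: every pair has `x − N/Ks − 1 < dm ≤ x`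
(`window_of_boundary`), `|G_U(m)| ≤ τ(m)`, `|λ| ≤ 1`; bound by the nonnegative majorant
`Λ(d) τ(m) 1[dm ≡ w] 1[x − N/Ks − 1 < dm]` over all `dm ≤ x`, regroup by `n = dm`
(`Vaughan.sum_Ioc_sum_divisorsAntidiagonal_eq`) and use `τ(m) ≤ τ(n)`,
`Σ_{d ∣ n} Λ(d) = log n ≤ log N` (`fibre_le`, `boundary_majorant_le`).
Template: the sup-norm engine `Theorems/LiouvilleMADTypeIIToLevelEngine(2).lean`.
[folklore; Vaughan 1980; Friedlander–Iwaniec 1998 §26; Iwaniec–Kowalski 2004 §13.4]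
-/

noncomputable section

open Finset Real
open ArithmeticFunction (liouville vonMangoldt_nonneg vonMangoldt_sum sigma_zero_apply)
open scoped ArithmeticFunction.vonMangoldt ArithmeticFunction.sigma

namespace Summit.Parity.GeneralizedHardyLittlewood.Theorems.LambdaLiouvilleLevel.LogPowerDispersion

open Literature.NumberTheory.Sieve.Vaughan (fU gU fU_apply gU_eq_zero_of_le abs_gU_le
  sum_Ioc_mul_two_pow_eq_sum sum_Ioc_sum_divisorsAntidiagonal_eq)
open Literature.NumberTheory.Sieve (abs_liouville_le_one sum_Ioc_mul_apply_mul_eq_sum_sum)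
open Literature.NumberTheory.Sieve.FriedlanderIwaniecPrimes.PrimeSumEngine
  (sum_Ioc_eq_sum_range_pieces)

namespace TypeIIPieceDecomp

/-- Dyadic blocks `(U2^i, 2U2^i]`, `i < J`, of `(U, U2^J]`, each cut into `Ks` consecutive pieces
at the cut points `E_{i,a} = U2^i + ⌊a U2^i / Ks⌋` (`E_{i,0} = U2^i`, `E_{i,Ks} = 2U2^i`).
[folklore] -/
theorem sum_Ioc_eq_sum_blocks_pieces {M : Type*} [AddCommMonoid M] (Φ : ℕ → M) (U J : ℕ)
    {Ks : ℕ} (hKs : 0 < Ks) :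
    ∑ d ∈ Ioc U (U * 2 ^ J), Φ d =
      ∑ i ∈ range J, ∑ a ∈ range Ks,
        ∑ d ∈ Ioc (U * 2 ^ i + a * (U * 2 ^ i) / Ks) (U * 2 ^ i + (a + 1) * (U * 2 ^ i) / Ks),
          Φ d := by
  rw [sum_Ioc_mul_two_pow_eq_sum]
  refine sum_congr rfl fun i _ => ?_
  have hEmono : Monotone (fun a : ℕ => U * 2 ^ i + a * (U * 2 ^ i) / Ks) := fun a b hab =>
    Nat.add_le_add_left (Nat.div_le_div_right (Nat.mul_le_mul_right _ hab)) _
  have h := sum_Ioc_eq_sum_range_pieces Φ hEmono Ks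
  simp only [zero_mul, Nat.zero_div, add_zero] at h
  rw [Nat.mul_div_cancel_left _ hKs] at h
  exact h

/-- `Σ_{d ≤ x} F_U(d) T(d) = Σ_{U < d ≤ U2^J} Λ(d) T(d)` for `x ≤ U2^J`, when `T(d)` is a sum
over `m ≤ x/d` (empty for `d > x`): `F_U = 0` on `d ≤ U` and `F_U = Λ` beyond `U`. [folklore] -/
theorem sum_fU_mul_eq_sum_vonMangoldt_mul (U J x : ℕ) (hxJ : x ≤ U * 2 ^ J) (G : ℕ → ℕ → ℝ) :
    ∑ d ∈ Ioc 0 x, fU U d * ∑ m ∈ Ioc 0 (x / d), G d m =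
      ∑ d ∈ Ioc U (U * 2 ^ J), Λ d * ∑ m ∈ Ioc 0 (x / d), G d m := by
  have hext : ∑ d ∈ Ioc 0 x, fU U d * ∑ m ∈ Ioc 0 (x / d), G d m =
      ∑ d ∈ Ioc 0 (U * 2 ^ J), fU U d * ∑ m ∈ Ioc 0 (x / d), G d m := by
    refine sum_subset (Ioc_subset_Ioc_right hxJ) fun d hd hdx => ?_
    rw [mem_Ioc, not_and, not_le] at hdx
    rw [Nat.div_eq_of_lt (hdx (mem_Ioc.1 hd).1)]
    simp
  rw [hext, ← sum_Ioc_consecutive _ (Nat.zero_le U)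
    (Nat.le_mul_of_pos_right U (Nat.two_pow_pos J))]
  have h0 : ∑ d ∈ Ioc 0 U, fU U d * ∑ m ∈ Ioc 0 (x / d), G d m = 0 :=
    sum_eq_zero fun d hd => by rw [fU_apply, if_pos (mem_Ioc.1 hd).2, zero_mul]
  rw [h0, zero_add]
  refine sum_congr rfl fun d hd => ?_
  rw [fU_apply, if_neg (not_le.2 (mem_Ioc.1 hd).1)]

/-- Splitting the inner range `m ≤ x/d` at `x/hi ≤ x/d` on a piece `d ∈ (lo, hi]`. [folklore] -/
theorem sum_piece_split (Φ : ℕ → ℝ) (G : ℕ → ℕ → ℝ) (x lo hi : ℕ) :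
    ∑ d ∈ Ioc lo hi, Φ d * ∑ m ∈ Ioc 0 (x / d), G d m =
      ∑ d ∈ Ioc lo hi, Φ d * ∑ m ∈ Ioc 0 (x / hi), G d m +
        ∑ d ∈ Ioc lo hi, Φ d * ∑ m ∈ Ioc (x / hi) (x / d), G d m := by
  rw [← sum_add_distrib]
  refine sum_congr rfl fun d hd => ?_
  rw [mem_Ioc] at hd
  rw [← mul_add, sum_Ioc_consecutive _ (Nat.zero_le _) (Nat.div_le_div_left hd.2 (by omega))]

/-- The indicator of a piece `(lo, hi] ⊆ (D, 2D]` inside the block sum. [folklore] -/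
theorem sum_indicator_Ioc_eq {D lo hi : ℕ} (hlo : D ≤ lo) (hhi : hi ≤ 2 * D) (α Y : ℕ → ℝ) :
    ∑ d ∈ Ioc D (2 * D), α d * (if lo < d ∧ d ≤ hi then (1 : ℝ) else 0) * Y d =
      ∑ d ∈ Ioc lo hi, α d * Y d := by
  rw [show Ioc lo hi = (Ioc D (2 * D)).filter (fun d => lo < d ∧ d ≤ hi) from ?_, sum_filter]
  · refine sum_congr rfl fun d _ => ?_
    split_ifs <;> simp
  · ext d
    simp only [mem_Ioc, mem_filter]
    omega

/-- The inner sum `Σ_{m ≤ X} β(m) ℓ(m)` (`β = 0` on `m ≤ U`, `X ≤ U2^J`, `X ≤ N/D`) as a sum over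
the dyadic boxes `(U2^j, 2U2^j]`, `j < J`, `D · U2^j ≤ N`, of `β(m) 1[m ≤ X] ℓ(m)`: the boxes with
`D · U2^j > N` do not meet `m ≤ X`. [folklore] -/
theorem inner_eq_sum_boxes {U J N D X : ℕ} (β ℓ : ℕ → ℝ) (hβ : ∀ m, m ≤ U → β m = 0)
    (hXJ : X ≤ U * 2 ^ J) (hXD : X ≤ N / D) (hD : 0 < D) :
    ∑ m ∈ Ioc 0 X, β m * ℓ m =
      ∑ j ∈ (range J).filter (fun j : ℕ => D * (U * 2 ^ j) ≤ N),
        ∑ m ∈ Ioc (U * 2 ^ j) (2 * (U * 2 ^ j)), β m * (if m ≤ X then (1 : ℝ) else 0) * ℓ m := by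
  have h1 : ∑ m ∈ Ioc 0 X, β m * ℓ m =
      ∑ m ∈ Ioc 0 (U * 2 ^ J), β m * (if m ≤ X then (1 : ℝ) else 0) * ℓ m := by
    rw [show Ioc 0 X = (Ioc 0 (U * 2 ^ J)).filter (fun m => m ≤ X) from ?_, sum_filter]
    · refine sum_congr rfl fun m _ => ?_
      split_ifs <;> simp
    · ext m
      simp only [mem_Ioc, mem_filter]
      omega
  rw [h1, ← sum_Ioc_consecutive _ (Nat.zero_le U) (Nat.le_mul_of_pos_right U (Nat.two_pow_pos J))]
  have h0 : ∑ m ∈ Ioc 0 U, β m * (if m ≤ X then (1 : ℝ) else 0) * ℓ m = 0 :=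
    sum_eq_zero fun m hm => by
      rw [mem_Ioc] at hm
      rw [hβ m hm.2, zero_mul, zero_mul]
  rw [h0, zero_add, sum_Ioc_mul_two_pow_eq_sum]
  simp_rw [← two_mul]
  symm
  refine sum_filter_of_ne fun j _ hne => ?_
  by_contra hjN
  refine hne (sum_eq_zero fun m hm => ?_)
  rw [mem_Ioc] at hm
  have hmX : ¬ m ≤ X := fun hmX => hjN <|
    calc D * (U * 2 ^ j) ≤ D * m := Nat.mul_le_mul_left D hm.1.le
      _ = m * D := mul_comm _ _
      _ ≤ N := (Nat.le_div_iff_mul_le hD).1 (hmX.trans hXD)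
  rw [if_neg hmX, mul_zero, zero_mul]

/-- **The main part on one piece is a sum of boxes** (exact identity).  For the block `D = U2^i`,
the piece `(lo, hi] = (E_{i,a}, E_{i,a+1}]` (`a < Ks`) and `X = ⌊x/hi⌋`:
`Σ_{lo < d ≤ hi} Λ(d) Σ_{m ≤ X} G_U(m) lam(dm) = Σ_{j < J, D U2^j ≤ N} Σ_{D < d ≤ 2D}
Σ_{U2^j < m ≤ 2U2^j} 1[dm ≡ w] (Λ(d) 1[lo < d ≤ hi]) (G_U(m) 1[m ≤ X]) λ(dm + h)`. [folklore] -/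
theorem main_piece_eq (h : ℤ) (U Ks J N x q w i a : ℕ) (hU : 0 < U) (hKs : 0 < Ks)
    (hxN : x ≤ N) (hNJ : N ≤ U * 2 ^ J) (ha : a < Ks) :
    ∑ d ∈ Ioc (U * 2 ^ i + a * (U * 2 ^ i) / Ks) (U * 2 ^ i + (a + 1) * (U * 2 ^ i) / Ks),
      Λ d * ∑ m ∈ Ioc 0 (x / (U * 2 ^ i + (a + 1) * (U * 2 ^ i) / Ks)),
        gU U m * (if d * m ≡ w [MOD q] then
          (liouville (Int.toNat (((d * m : ℕ) : ℤ) + h)) : ℝ) else 0) =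
    ∑ j ∈ (range J).filter (fun j : ℕ => (U * 2 ^ i) * (U * 2 ^ j) ≤ N),
      ∑ d ∈ Ioc (U * 2 ^ i) (2 * (U * 2 ^ i)), ∑ m ∈ Ioc (U * 2 ^ j) (2 * (U * 2 ^ j)),
        (if d * m ≡ w [MOD q] then
          (Λ d * (if U * 2 ^ i + a * (U * 2 ^ i) / Ks < d ∧
              d ≤ U * 2 ^ i + (a + 1) * (U * 2 ^ i) / Ks then (1 : ℝ) else 0)) *
            (gU U m * (if m ≤ x / (U * 2 ^ i + (a + 1) * (U * 2 ^ i) / Ks)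
              then (1 : ℝ) else 0)) *
            (liouville (Int.toNat (((d * m : ℕ) : ℤ) + h)) : ℝ)
         else 0) := by
  set D := U * 2 ^ i with hD
  set lo := D + a * D / Ks with hlo
  set hi := D + (a + 1) * D / Ks with hhi
  set X := x / hi with hX
  have hD0 : 0 < D := mul_pos hU (Nat.two_pow_pos i)
  have hDlo : D ≤ lo := Nat.le_add_right D _
  have hq1 : (a + 1) * D / Ks ≤ D :=
    calc (a + 1) * D / Ks ≤ Ks * D / Ks := Nat.div_le_div_right (Nat.mul_le_mul_right D ha)
      _ = D := Nat.mul_div_cancel_left D hKs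
  have hhi2 : hi ≤ 2 * D := by omega
  have hDhi : D ≤ hi := Nat.le_add_right D _
  have hXJ : X ≤ U * 2 ^ J := by
    rw [hX]
    exact (Nat.div_le_self x hi).trans (hxN.trans hNJ)
  have hXD : X ≤ N / D := by
    rw [hX]
    exact (Nat.div_le_div_left hDhi hD0).trans (Nat.div_le_div_right hxN)
  -- the summand of the right-hand side
  have hsummand : ∀ d m : ℕ,
      (if d * m ≡ w [MOD q] then
          Λ d * (if lo < d ∧ d ≤ hi then (1 : ℝ) else 0) *
            (gU U m * (if m ≤ X then (1 : ℝ) else 0)) *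
            (liouville (Int.toNat (((d * m : ℕ) : ℤ) + h)) : ℝ)
        else 0) =
      Λ d * (if lo < d ∧ d ≤ hi then (1 : ℝ) else 0) *
        ((gU U m * (if m ≤ X then (1 : ℝ) else 0)) *
          (if d * m ≡ w [MOD q] then
            (liouville (Int.toNat (((d * m : ℕ) : ℤ) + h)) : ℝ) else 0)) := by
    intro d m
    split_ifs <;> ring
  simp_rw [hsummand, ← mul_sum]
  conv_rhs => rw [sum_comm]
  simp_rw [← mul_sum]
  rw [sum_indicator_Ioc_eq hDlo hhi2]
  refine sum_congr rfl fun d _ => ?_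
  congr 1
  exact inner_eq_sum_boxes (fun m => gU U m)
    (fun m => if d * m ≡ w [MOD q] then (liouville (Int.toNat (((d * m : ℕ) : ℤ) + h)) : ℝ) else 0)
    (fun m hm => gU_eq_zero_of_le hm) hXJ hXD hD0

/-- **Boundary pairs lie in the short window**: for `d ∈ (E_a, E_{a+1}]` (`E_a = D + ⌊aD/Ks⌋`)
and `x/E_{a+1} < m ≤ x/d`, `x − (N/Ks + 1) < dm`, since `x < m E_{a+1} ≤ m (d + D/Ks)` and
`m (D/Ks) ≤ (x/d) D / Ks ≤ x/Ks`. [folklore] -/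
theorem window_of_boundary {D Ks x N a d m : ℕ} (hD : 0 < D) (hKs : 0 < Ks) (hxN : x ≤ N)
    (hd : D + a * D / Ks < d) (hm1 : x / (D + (a + 1) * D / Ks) < m) (hm2 : m ≤ x / d) :
    x - (N / Ks + 1) < d * m := by
  have hstep : (a + 1) * D / Ks ≤ a * D / Ks + D / Ks + 1 := by
    rw [add_mul, one_mul, Nat.add_div hKs]
    split_ifs <;> omega
  have hhi : D + (a + 1) * D / Ks ≤ d + D / Ks := by omega
  have hDd : D ≤ d := (lt_of_le_of_lt (Nat.le_add_right D _) hd).le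
  have hx1 : x < m * (D + (a + 1) * D / Ks) :=
    (Nat.div_lt_iff_lt_mul (lt_of_lt_of_le hD (Nat.le_add_right D _))).1 hm1
  have hx2 : x < m * d + m * (D / Ks) :=
    calc x < m * (D + (a + 1) * D / Ks) := hx1
      _ ≤ m * (d + D / Ks) := Nat.mul_le_mul_left m hhi
      _ = m * d + m * (D / Ks) := mul_add _ _ _
  have hx3 : m * (D / Ks) ≤ N / Ks :=
    calc m * (D / Ks) ≤ x / d * (D / Ks) := Nat.mul_le_mul_right _ hm2
      _ ≤ x / d * D / Ks := Nat.mul_div_le_mul_div_assoc _ _ _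
      _ ≤ x / Ks := Nat.div_le_div_right
          ((Nat.mul_le_mul_left (x / d) hDd).trans (Nat.div_mul_le_self x d))
      _ ≤ N / Ks := Nat.div_le_div_right hxN
  have hx4 : x < d * m + N / Ks := by
    rw [mul_comm d m]
    omega
  have hdm : 0 < d * m :=
    mul_pos (lt_of_le_of_lt (Nat.zero_le _) hd) (lt_of_le_of_lt (Nat.zero_le _) hm1)
  omega

/-- **The boundary part on one piece, termwise** (`|G_U| ≤ τ`, `|λ| ≤ 1`, `window_of_boundary`):
the strip `x/E_{a+1} < m ≤ x/d` is bounded by the nonnegative majorant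
`Λ(d) τ(m) 1[dm ≡ w (q)] 1[x − N/Ks − 1 < dm]` summed over all `m ≤ x/d`. [folklore] -/
theorem boundary_piece_le (h : ℤ) {U Ks N x : ℕ} (q w i a : ℕ) (hU : 0 < U) (hKs : 0 < Ks)
    (hxN : x ≤ N) :
    |∑ d ∈ Ioc (U * 2 ^ i + a * (U * 2 ^ i) / Ks) (U * 2 ^ i + (a + 1) * (U * 2 ^ i) / Ks),
        Λ d * ∑ m ∈ Ioc (x / (U * 2 ^ i + (a + 1) * (U * 2 ^ i) / Ks)) (x / d),
          gU U m * (if d * m ≡ w [MOD q] then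
            (liouville (Int.toNat (((d * m : ℕ) : ℤ) + h)) : ℝ) else 0)| ≤
      ∑ d ∈ Ioc (U * 2 ^ i + a * (U * 2 ^ i) / Ks) (U * 2 ^ i + (a + 1) * (U * 2 ^ i) / Ks),
        Λ d * ∑ m ∈ Ioc 0 (x / d), ((Nat.divisors m).card : ℝ) *
          (if d * m ≡ w [MOD q] ∧ x - (N / Ks + 1) < d * m then (1 : ℝ) else 0) := by
  have hD0 : 0 < U * 2 ^ i := mul_pos hU (Nat.two_pow_pos i)
  refine (abs_sum_le_sum_abs _ _).trans (sum_le_sum fun d hd => ?_)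
  rw [mem_Ioc] at hd
  rw [abs_mul, abs_of_nonneg vonMangoldt_nonneg]
  refine mul_le_mul_of_nonneg_left ?_ vonMangoldt_nonneg
  refine (abs_sum_le_sum_abs _ _).trans ((sum_le_sum fun m hm => ?_).trans
    (sum_le_sum_of_subset_of_nonneg (Ioc_subset_Ioc_left (Nat.zero_le _)) fun m _ _ => ?_))
  · rw [mem_Ioc] at hm
    have hwin : x - (N / Ks + 1) < d * m := window_of_boundary hD0 hKs hxN hd.1 hm.1 hm.2
    have hg : |gU U m| ≤ ((Nat.divisors m).card : ℝ) := by
      have := abs_gU_le U m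
      rwa [sigma_zero_apply] at this
    rw [abs_mul]
    by_cases hc : d * m ≡ w [MOD q]
    · rw [if_pos hc, if_pos (And.intro hc hwin), mul_one]
      calc |gU U m| * |(liouville (Int.toNat (((d * m : ℕ) : ℤ) + h)) : ℝ)|
          ≤ ((Nat.divisors m).card : ℝ) * 1 :=
            mul_le_mul hg (abs_liouville_le_one _) (abs_nonneg _) (Nat.cast_nonneg _)
        _ = ((Nat.divisors m).card : ℝ) := mul_one _
    · rw [if_neg hc, abs_zero, mul_zero]
      positivity
  · positivity

/-- **Dirichlet regrouping of a nonnegative majorant**: if `F ≥ 0` and every fibre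
`Σ_{dm = n} Λ(d) F(d, m)`, `n ≤ x`, is at most `T(n)`, then
`Σ_{U < d ≤ U2^J} Λ(d) Σ_{m ≤ x/d} F(d, m) ≤ Σ_{n ≤ x} T(n)` (`x ≤ U2^J`). [folklore] -/
theorem sum_mul_sum_le_of_fibre {x U J : ℕ} {T : ℕ → ℝ} {F : ℕ → ℕ → ℝ} (hF : ∀ d m, 0 ≤ F d m)
    (hfib : ∀ n ∈ Ioc 0 x, ∑ p ∈ n.divisorsAntidiagonal, Λ p.1 * F p.1 p.2 ≤ T n)
    (hxJ : x ≤ U * 2 ^ J) :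
    ∑ d ∈ Ioc U (U * 2 ^ J), Λ d * ∑ m ∈ Ioc 0 (x / d), F d m ≤ ∑ n ∈ Ioc 0 x, T n := by
  have hT0 : ∀ d, (0 : ℝ) ≤ Λ d * ∑ m ∈ Ioc 0 (x / d), F d m :=
    fun d => mul_nonneg vonMangoldt_nonneg (sum_nonneg fun m _ => hF d m)
  calc ∑ d ∈ Ioc U (U * 2 ^ J), Λ d * ∑ m ∈ Ioc 0 (x / d), F d m
      ≤ ∑ d ∈ Ioc 0 (U * 2 ^ J), Λ d * ∑ m ∈ Ioc 0 (x / d), F d m :=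
        sum_le_sum_of_subset_of_nonneg (Ioc_subset_Ioc_left (Nat.zero_le U)) fun d _ _ => hT0 d
    _ = ∑ d ∈ Ioc 0 x, Λ d * ∑ m ∈ Ioc 0 (x / d), F d m := by
        symm
        refine sum_subset (Ioc_subset_Ioc_right hxJ) fun d hd hdx => ?_
        rw [mem_Ioc, not_and, not_le] at hdx
        rw [Nat.div_eq_of_lt (hdx (mem_Ioc.1 hd).1)]
        simp
    _ = ∑ n ∈ Ioc 0 x, ∑ p ∈ n.divisorsAntidiagonal, Λ p.1 * F p.1 p.2 := by
        rw [sum_Ioc_sum_divisorsAntidiagonal_eq (fun d m => Λ d * F d m) x]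
        simp only [mul_sum]
    _ ≤ ∑ n ∈ Ioc 0 x, T n := sum_le_sum hfib

/-- **The fibre bound** (`1 ≤ n ≤ x ≤ N`): `Σ_{dm = n} Λ(d) τ(m) 1[dm ≡ w] 1[x − Δ < dm] ≤
1[n ≡ w ∧ x − Δ < n] τ(n) log N` (`τ(m) ≤ τ(n)` for `m ∣ n`, `Σ_{d ∣ n} Λ(d) = log n`).
[folklore] -/
theorem fibre_le {x N q w Δ n : ℕ} (hn : n ∈ Ioc 0 x) (hxN : x ≤ N) :
    ∑ p ∈ n.divisorsAntidiagonal, Λ p.1 * (((Nat.divisors p.2).card : ℝ) *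
        (if p.1 * p.2 ≡ w [MOD q] ∧ x - Δ < p.1 * p.2 then (1 : ℝ) else 0)) ≤
      if n ≡ w [MOD q] ∧ x - Δ < n then ((Nat.divisors n).card : ℝ) * Real.log N else 0 := by
  rw [mem_Ioc] at hn
  have hn0 : n ≠ 0 := by omega
  have h1 : ∀ p ∈ n.divisorsAntidiagonal, Λ p.1 * (((Nat.divisors p.2).card : ℝ) *
      (if p.1 * p.2 ≡ w [MOD q] ∧ x - Δ < p.1 * p.2 then (1 : ℝ) else 0)) =
      (if n ≡ w [MOD q] ∧ x - Δ < n then (1 : ℝ) else 0) *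
        (Λ p.1 * ((Nat.divisors p.2).card : ℝ)) := by
    intro p hp
    rw [(Nat.mem_divisorsAntidiagonal.1 hp).1]
    ring
  rw [sum_congr rfl h1, ← mul_sum]
  split_ifs with hc
  · rw [one_mul]
    have hτ : ∀ p ∈ n.divisorsAntidiagonal, Λ p.1 * ((Nat.divisors p.2).card : ℝ) ≤
        Λ p.1 * ((Nat.divisors n).card : ℝ) := by
      intro p hp
      have hp2 : p.2 ∣ n := Dvd.intro_left _ (Nat.mem_divisorsAntidiagonal.1 hp).1
      refine mul_le_mul_of_nonneg_left ?_ vonMangoldt_nonneg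
      exact_mod_cast card_le_card (Nat.divisors_subset_of_dvd hn0 hp2)
    refine (sum_le_sum hτ).trans ?_
    rw [← sum_mul, Nat.sum_divisorsAntidiagonal (fun d _ => Λ d), vonMangoldt_sum, mul_comm]
    refine mul_le_mul_of_nonneg_left (Real.log_le_log ?_ ?_) (Nat.cast_nonneg _)
    · exact_mod_cast hn.1
    · exact_mod_cast hn.2.trans hxN
  · rw [zero_mul]

/-- **The boundary majorant is a class-restricted divisor sum over the short window**:
`Σ_i Σ_a Σ_{d ∈ piece} Λ(d) Σ_{m ≤ x/d} τ(m) 1[dm ≡ w] 1[x − N/Ks − 1 < dm]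
≤ log N · Σ_{x − N/Ks − 1 < n ≤ x, n ≡ w (q)} τ(n)`. [folklore] -/
theorem boundary_majorant_le (U Ks J N x q w : ℕ) (hKs : 0 < Ks) (hxN : x ≤ N)
    (hxJ : x ≤ U * 2 ^ J) :
    ∑ i ∈ range J, ∑ a ∈ range Ks,
      ∑ d ∈ Ioc (U * 2 ^ i + a * (U * 2 ^ i) / Ks) (U * 2 ^ i + (a + 1) * (U * 2 ^ i) / Ks),
        Λ d * ∑ m ∈ Ioc 0 (x / d), ((Nat.divisors m).card : ℝ) *
          (if d * m ≡ w [MOD q] ∧ x - (N / Ks + 1) < d * m then (1 : ℝ) else 0) ≤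
      Real.log N * ∑ n ∈ (Ioc (x - (N / Ks + 1)) x).filter (fun n : ℕ => n ≡ w [MOD q]),
        ((Nat.divisors n).card : ℝ) := by
  rw [← sum_Ioc_eq_sum_blocks_pieces _ U J hKs]
  have hF0 : ∀ d m : ℕ, (0 : ℝ) ≤ ((Nat.divisors m).card : ℝ) *
      (if d * m ≡ w [MOD q] ∧ x - (N / Ks + 1) < d * m then (1 : ℝ) else 0) :=
    fun d m => by positivity
  refine (sum_mul_sum_le_of_fibre
    (F := fun d m => ((Nat.divisors m).card : ℝ) *
      (if d * m ≡ w [MOD q] ∧ x - (N / Ks + 1) < d * m then (1 : ℝ) else 0))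
    (T := fun n => if n ≡ w [MOD q] ∧ x - (N / Ks + 1) < n then
      ((Nat.divisors n).card : ℝ) * Real.log N else 0)
    hF0 (fun n hn => fibre_le hn hxN) hxJ).trans (le_of_eq ?_)
  show ∑ n ∈ Ioc 0 x, (if n ≡ w [MOD q] ∧ x - (N / Ks + 1) < n then
      ((Nat.divisors n).card : ℝ) * Real.log N else 0) = _
  rw [← sum_filter, mul_sum]
  have hS : (Ioc 0 x).filter (fun n => n ≡ w [MOD q] ∧ x - (N / Ks + 1) < n) =
      (Ioc (x - (N / Ks + 1)) x).filter (fun n : ℕ => n ≡ w [MOD q]) := by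
    ext n
    simp only [mem_filter, mem_Ioc]
    constructor
    · rintro ⟨⟨-, h2⟩, h3, h4⟩
      exact ⟨⟨h4, h2⟩, h3⟩
    · rintro ⟨⟨h1, h2⟩, h3⟩
      exact ⟨⟨by omega, h2⟩, h3, h1⟩
  rw [hS]
  exact sum_congr rfl fun n _ => mul_comm _ _

end TypeIIPieceDecomp

open TypeIIPieceDecomp in
/-- **The type-II piece of Vaughan's identity, decomposed (one modulus; exact combinatorics plus
trivial bounds)** — the skeleton's `TypeIIPieceDecomp`, unfolded: for `U ≥ 2`, `Ks ≥ 1`,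
`x ≤ N ≤ U·2^J`, `q ≥ 1`, any `w`, `h`,
`|Σ_{n ≤ x} (F_U * G_U)(n) 1[n ≡ w (q)] λ(n + h)| ≤ Σ_{i<J} Σ_{a<Ks} Σ_{j<J, U2^i U2^j ≤ N}
|B_{i,a,j}| + log N · Σ_{x − N/Ks − 1 < n ≤ x, n ≡ w (q)} τ(n)` with the `ClassTypeIILog`-shaped
boxes `B_{i,a,j}` (`main_piece_eq`, `boundary_piece_le`, `boundary_majorant_le`).
[folklore; Vaughan 1980; Friedlander–Iwaniec 1998 §26; Iwaniec–Kowalski 2004 §13.4] -/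
theorem typeIIPieceDecomp :
  ∀ (h : ℤ) (U Ks J N x q w : ℕ), 2 ≤ U → 0 < Ks → x ≤ N → N ≤ U * 2 ^ J → 1 ≤ q →
    |∑ n ∈ Finset.Ioc 0 x, (fU U * gU U) n *
        (if n ≡ w [MOD q] then (ArithmeticFunction.liouville (Int.toNat ((n : ℤ) + h)) : ℝ) else 0)| ≤
      (∑ i ∈ Finset.range J, ∑ a ∈ Finset.range Ks,
        ∑ j ∈ (Finset.range J).filter (fun j : ℕ => (U * 2 ^ i) * (U * 2 ^ j) ≤ N),
          |∑ d ∈ Finset.Ioc (U * 2 ^ i) (2 * (U * 2 ^ i)), ∑ m ∈ Finset.Ioc (U * 2 ^ j) (2 * (U * 2 ^ j)),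
            (if d * m ≡ w [MOD q] then
              (ArithmeticFunction.vonMangoldt d *
                  (if U * 2 ^ i + a * (U * 2 ^ i) / Ks < d ∧ d ≤ U * 2 ^ i + (a + 1) * (U * 2 ^ i) / Ks
                   then (1 : ℝ) else 0)) *
                (gU U m * (if m ≤ x / (U * 2 ^ i + (a + 1) * (U * 2 ^ i) / Ks) then (1 : ℝ) else 0)) *
                (ArithmeticFunction.liouville (Int.toNat (((d * m : ℕ) : ℤ) + h)) : ℝ)
             else 0)|) +
        Real.log N * ∑ n ∈ (Finset.Ioc (x - (N / Ks + 1)) x).filter (fun n : ℕ => n ≡ w [MOD q]),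
          ((Nat.divisors n).card : ℝ) := by
  intro h U Ks J N x q w hU hKs hxN hNJ _hq
  have hU0 : 0 < U := by omega
  rw [sum_Ioc_mul_apply_mul_eq_sum_sum, sum_fU_mul_eq_sum_vonMangoldt_mul U J x (hxN.trans hNJ),
    sum_Ioc_eq_sum_blocks_pieces _ U J hKs]
  simp only [sum_piece_split, sum_add_distrib]
  refine (abs_add_le _ _).trans (add_le_add ?_ ?_)
  · refine (abs_sum_le_sum_abs _ _).trans (sum_le_sum fun i _ => ?_)
    refine (abs_sum_le_sum_abs _ _).trans (sum_le_sum fun a ha => ?_)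
    rw [main_piece_eq h U Ks J N x q w i a hU0 hKs hxN hNJ (mem_range.1 ha)]
    exact abs_sum_le_sum_abs _ _
  · refine le_trans ?_ (boundary_majorant_le U Ks J N x q w hKs hxN (hxN.trans hNJ))
    refine (abs_sum_le_sum_abs _ _).trans (sum_le_sum fun i _ => ?_)
    refine (abs_sum_le_sum_abs _ _).trans (sum_le_sum fun a _ => ?_)
    exact boundary_piece_le h q w i a hU0 hKs hxN

end Summit.Parity.GeneralizedHardyLittlewood.Theorems.LambdaLiouvilleLevel.LogPowerDispersion

end
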